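import Mathlib.AlgebraicGeometry.EllipticCurve.Affine.Point
import Mathlib.Algebra.Group.AddChar
import Mathlib.Algebra.CharP.Defs
import Mathlib.Algebra.Field.ZMod
import Mathlib.Analysis.Complex.Basic
import Mathlib.Analysis.Real.Sqrt
import HarnessLib

/-!
# Kohel–Shparlinski bounds for character sums over the points of an elliptic curve over `𝔽_q`

Topic `NumberTheory/EllipticCurves`. Vendored (work item wi-09506) for route
`PneNP/EcdlpDefinability` (cruxes `DefinableLogBound`, `IntervalPointSetEnergy`), which needs the
Kohel–Shparlinski estimate for additive-character sums of the `x`-coordinate along (subgroups of)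
`E(𝔽_p)`, twisted by characters of the finite abelian group `E(𝔽_p)`, as a citable hypothesis
(completion arguments).

## The source [KohelShparlinski2000]

D. R. Kohel and I. E. Shparlinski, *On exponential sums and group generators for elliptic curves
over finite fields*, ANTS-IV, LNCS 1838 (2000), 395–404. Let `q = pᵏ`, `E / 𝔽_q` an elliptic
curve in Weierstrass form (1), `Ω = Hom(E(𝔽_q), ℂ*)` the character group of the group of rational
points, `Ψ = Hom(𝔽_q, ℂ*)` the additive characters (`ψ(z) = e_p(Tr(αz))`), and for `ω ∈ Ω`,
`ψ ∈ Ψ`, `f ∈ 𝔽_q(E)` and a subgroup `H ≤ E(𝔽_q)` (§1, p. 396 and §3, p. 399)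
`S_H(ω, ψ, f) = Σ_{P ∈ H, f(P) ≠ ∞} ω(P) ψ(f(P))`, `S = S_{E(𝔽_q)}`.

* **Theorem 1** (p. 398). Write `(f)_∞ = Σᵢ nᵢ Pᵢ` (`f` nonconstant). Then `ω` determines an
  unramified character, `ψ ∘ f` a character of conductor `Σᵢ mᵢ Pᵢ` with `mᵢ ≤ nᵢ + 1` and
  equality iff `(nᵢ, q) = 1`, and `|S(ω, ψ, f)| ≤ Σᵢ mᵢ deg(Pᵢ) q^{1/2}`. Hence **(3)**
  `|S(ω, ψ, f)| ≤ 2 deg(f) q^{1/2}`, and `≤ (1 + deg f) q^{1/2}` if `(f)_∞` is supported at a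
  single prime divisor (p. 399). Proof: `L(E, ω · (ψ ∘ f), t)` is a polynomial of degree
  `2g - 2 + deg 𝔣` (Prop. 1 = [Bombieri 1966, Thm A] = [Weil, *Basic Number Theory*, VII Thm 6])
  whose inverse roots have absolute value `q^{1/2}` (Prop. 2, the Riemann hypothesis for curves),
  the conductor of `ψ ∘ f` being that of [Bombieri 1966, §VI Thm 5].
* **Corollary 1** (p. 399). For `f` nonconstant and `ψ` nontrivial,
  `|S_H(ω, ψ, f)| ≤ 2 deg(f) q^{1/2}` for every subgroup `H` and every `ω ∈ Ω`
  (average (3) over the characters of `E(𝔽_q)/H`).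
* `deg x = 2`, `deg y = 3` (p. 398): the cases the paper is "in particular interested in" (p. 396)
  and the ones it uses (Cor. 2, p. 401: "take either `f = x` if `p ≠ 2` or `f = y` if `p ≠ 3`").

## What is vendored, and why the characteristic guard

We vendor Corollary 1 for the two coordinate functions as ONE named fact
`KohelShparlinski.CoordinateCharSumBound` (a `Prop`, D-0014). It is PROVED in the tree: the
discharge `KohelShparlinski.CoordinateCharSumBound_holds` lives in the sibling module
`Literature.NumberTheory.EllipticCurves.KohelShparlinskiCoordinateCharSumBoundProofs` (which
imports this file, so the proof cannot sit here) — Bombieri–Weil for the Artin–Schreier covers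
`zᵖ - z = αf` of `E` via the Lang torsor, following §§2–3 of the source; consumers feed
`CoordinateCharSumBound_holds` to the `(hKS : CoordinateCharSumBound)` corollaries below.
The statement:
for `H ≤ E(𝔽_q)`, `ω ∈ Ω` and nontrivial `ψ`,
`|S_H(ω, ψ, x)| ≤ 4 q^{1/2}` provided `p ≠ 2`, and `|S_H(ω, ψ, y)| ≤ 6 q^{1/2}` provided `p ≠ 3`;
the full-group case `H = E(𝔽_q)` (inequality (3)) and the untwisted case `ω = ω₀` are derived
below as theorems.

The guard `p ∤ deg f` is the paper's own (Cor. 2) and it is necessary: when `p ∣ nᵢ` (the case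
`mᵢ < nᵢ + 1` of Theorem 1) the character `ψ ∘ f` can be unramified at `Pᵢ`, hence everywhere,
and can then coincide with `ω⁻¹` for some `ω ∈ Ω`; then `ω · (ψ ∘ f)` is trivial, Proposition 1
does not apply, and (3) and Cor. 1 fail as printed. Explicitly: `q = 2ᵏ`,
`E : y² + xy = x³ + a₂x² + a₆` (`a₆ ≠ 0`), `ψ₁(z) = (-1)^{Tr z}` (nontrivial). For an affine
`P = (x, y) ∈ E(𝔽_q)`: `P ∈ 2E(𝔽_q) ↔ Tr(x + a₂) = 0` (if `λ² + λ = x + a₂` then, with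
`u² = y + (λ + 1)x` and `v = u(λ + u)`, the point `Q = (u, v)` lies on `E` — the condition
reduces to `2(x³ + a₂x² + a₆) = 0` — and `2Q = P` by the duplication formula
`x(2Q) = λ² + λ + a₂`, `λ = u + v/u`; conversely `Tr(λ² + λ + a₂) = Tr a₂`), and
`[E(𝔽_q) : 2E(𝔽_q)] = #E(𝔽_q)[2] = 2`. So `ω₀(P) = (-1)^{Tr(x(P) + a₂)}` (`ω₀(O) = 1`) is a
character of `E(𝔽_q)`, every affine `P` contributes `ω₀(P)ψ₁(x(P)) = (-1)^{Tr a₂}` and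
`|S(ω₀, ψ₁, x)| = N - 1 ≥ q - 2√q > 4√q = 2 deg(x) q^{1/2}` as soon as `q ≥ 64`.
For `f = x, p ≠ 2` and `f = y, p ≠ 3` the only pole is `O`, of order `deg f` prime to `p`, so
`ψ ∘ f` is totally ramified at `O` with conductor exponent `deg f + 1`, `ω · (ψ ∘ f)` is ramified
hence nontrivial, and Theorem 1 applies as printed (indeed with the sharper constant `1 + deg f`
of p. 399, which we do not vendor).

Deliberately NOT here: general `f ∈ 𝔽_q(E)` (needs the polar divisor of a function on `E`, and
the non-degeneracy hypothesis `f ∉ ℘(𝔽_q(E)) + 𝔽_q` left implicit in the source — e.g.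
`f = x + a₂ + a₆/x² = (y/x)² + (y/x)` on the curve above has `ψ₁(f(P)) = 1` whenever
`x(P) ≠ 0`); Theorem 2 / Corollary 2 (points in intervals, generating sets) and the
`O(q^{1/2+ε})` group-structure algorithm (§5).

## Lean rendering

* `E(𝔽_q)` is Mathlib's `W.toAffine.Point` (affine nonsingular points and `O = 0`) with its group
  law, for `W : WeierstrassCurve F`, `[W.IsElliptic]`, `F` a finite field
  (`[Field F] [Fintype F] [DecidableEq F]`; `q = Fintype.card F`, `p = ringChar F`);
  `ω : AddChar W.toAffine.Point ℂ`, `ψ : AddChar F ℂ` with `ψ ≠ 0` (Mathlib's spelling of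
  "`ψ` nontrivial"; `(0 : AddChar F ℂ) = 1` is the trivial character); `H : AddSubgroup _`.
* `S_H(ω, ψ, f)` for `f` a function of the affine coordinates (then `f(P) ≠ ∞ ↔ P ≠ O`) is
  `KohelShparlinski.affineCharSum W H ω ψ f`: the sum over `(x, y) ∈ F × F` with `W` nonsingular
  at `(x, y)` and `(x, y) ∈ H` of `ω((x, y)) · ψ(f x y)` — the `dite`-sum over `F × F` used by the
  route's statements (Mathlib has no `Fintype` instance on `W.toAffine.Point`); classical
  decidability inside.
* Universe-monomorphic (`F : Type`), matching the consumers (`ZMod p`, `GaloisField p n`).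

## Mathlib / Literature search

Mathlib (pin v4.32.0): `AddChar`, `ZMod.stdAddChar`, Gauss and Jacobi sums, the group law on
`WeierstrassCurve.Affine.Point`; no character sums over curves. Literature: `HasseManin` (Hasse's
bound, proved), `FunctionFieldZeta.hasseWeil` (RH for function fields, named fact),
`FunctionFieldStepanovProofs`; nothing on the sums `Σ ω(P) ψ(f(P))`
(`lean search 'Kohel|Shparlinski'`: docstring mentions only).

## References

* [KohelShparlinski2000] D. R. Kohel, I. E. Shparlinski, *On exponential sums and group
  generators for elliptic curves over finite fields*, Algorithmic Number Theory (ANTS-IV),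
  LNCS 1838, Springer 2000, 395–404, doi:10.1007/10722028_24 — Theorem 1, (3), Corollary 1
  (pp. 398–399); Corollary 2 (p. 401) for the characteristic guard.
* E. Bombieri, *On exponential sums in finite fields*, Amer. J. Math. 88 (1966), 71–105,
  Thm A and §VI Thm 5 (the source's [2]).
* A. Weil, *Basic Number Theory*, Springer 1974, Ch. VII (the source's [20]).
-/

noncomputable section

namespace Literature.NumberTheory.EllipticCurves

namespace KohelShparlinski

variable {F : Type} [Field F] [Fintype F] [DecidableEq F]

open scoped Classical in
/-- **The character sum `S_H(ω, ψ, f)`** of [KohelShparlinski2000, §3 p. 399] for a function `f`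
of the affine coordinates: `S_H(ω, ψ, f) = Σ_{P ∈ H, P ≠ O} ω(P) ψ(f(P))`, the sum over the affine
points `P = (x, y)` of the subgroup `H ≤ E(𝔽_q)` of the group character `ω` times the additive
character `ψ` at `f(x, y)`; written as a sum over `(x, y) ∈ F × F` restricted (by `dite`) to the
nonsingular solutions of the Weierstrass equation lying in `H`. For `f = fun x _ => x` this is
`S_H(ω, ψ, x)`, for `f = fun _ y => y` it is `S_H(ω, ψ, y)` (`x`, `y` have their only pole at
`O`, so "`f(P) ≠ ∞`" is "`P ≠ O`"). [cite: KohelShparlinski2000, §3 (definition of S_H)] -/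
def affineCharSum (W : WeierstrassCurve F) (H : AddSubgroup W.toAffine.Point)
    (ω : AddChar W.toAffine.Point ℂ) (ψ : AddChar F ℂ) (f : F → F → F) : ℂ :=
  ∑ xy : F × F,
    if h : W.toAffine.Nonsingular xy.1 xy.2 then
      (if WeierstrassCurve.Affine.Point.some xy.1 xy.2 h ∈ H then
        ω (WeierstrassCurve.Affine.Point.some xy.1 xy.2 h) * ψ (f xy.1 xy.2) else 0)
    else 0

open scoped Classical in
/-- `S(ω, ψ, f) = S_{E(𝔽_q)}(ω, ψ, f)`: for the full group the membership condition disappears.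
[cite: KohelShparlinski2000, §1 (definition of S)] -/
theorem affineCharSum_top (W : WeierstrassCurve F) (ω : AddChar W.toAffine.Point ℂ)
    (ψ : AddChar F ℂ) (f : F → F → F) :
    affineCharSum W ⊤ ω ψ f = ∑ xy : F × F,
      if h : W.toAffine.Nonsingular xy.1 xy.2 then
        ω (WeierstrassCurve.Affine.Point.some xy.1 xy.2 h) * ψ (f xy.1 xy.2) else 0 := by
  simp [affineCharSum]

open scoped Classical in
/-- The untwisted sum `S_H(ω₀, ψ, f) = Σ_{P ∈ H, P ≠ O} ψ(f(P))` (`ω₀ = 1 = 0` the trivial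
character of `E(𝔽_q)`). [cite: KohelShparlinski2000, §3] -/
theorem affineCharSum_one (W : WeierstrassCurve F) (H : AddSubgroup W.toAffine.Point)
    (ψ : AddChar F ℂ) (f : F → F → F) :
    affineCharSum W H 1 ψ f = ∑ xy : F × F,
      if h : W.toAffine.Nonsingular xy.1 xy.2 then
        (if WeierstrassCurve.Affine.Point.some xy.1 xy.2 h ∈ H then ψ (f xy.1 xy.2) else 0)
      else 0 := by
  simp [affineCharSum]

/-- For the trivial subgroup only `O ∈ H`, which is not an affine point: `S_{0}(ω, ψ, f) = 0`.
[folklore] -/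
theorem affineCharSum_bot (W : WeierstrassCurve F) (ω : AddChar W.toAffine.Point ℂ)
    (ψ : AddChar F ℂ) (f : F → F → F) : affineCharSum W ⊥ ω ψ f = 0 := by
  classical
  unfold affineCharSum
  refine Finset.sum_eq_zero fun xy _ => ?_
  split_ifs with h hmem
  · exact absurd (AddSubgroup.mem_bot.mp hmem) (by rintro ⟨⟩)
  · rfl
  · rfl

/-- **Kohel–Shparlinski, Corollary 1 (with Theorem 1 and inequality (3)) for the coordinate
functions `x` and `y`.** Let `E` be an elliptic curve over the finite field `𝔽_q` of
characteristic `p`, `H ≤ E(𝔽_q)` a subgroup, `ω ∈ Hom(E(𝔽_q), ℂ*)` a character of the group of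
points and `ψ` a nontrivial additive character of `𝔽_q`. Then
`|S_H(ω, ψ, x)| = |Σ_{P ∈ H, P ≠ O} ω(P) ψ(x(P))| ≤ 2 · deg(x) · q^{1/2} = 4 q^{1/2}` if `p ≠ 2`,
and `|S_H(ω, ψ, y)| ≤ 2 · deg(y) · q^{1/2} = 6 q^{1/2}` if `p ≠ 3` (`deg x = 2`, `deg y = 3`,
p. 398). Scope: exactly the cases `f = x`, `f = y` singled out on p. 396, with the characteristic
guard the paper imposes in Cor. 2 (`p ∤ deg f`, the case `m = deg f + 1` of Theorem 1, where
`ψ ∘ f` is totally ramified at `O`); without the guard the printed inequality fails (module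
docstring: in characteristic `2`, `S(ω₀, ψ₁, x) = ±(#E(𝔽_q) - 1)` for the halving character
`ω₀`). A named fact; its proof (Bombieri–Weil: RH for the Artin–Schreier covers of `E`) is
`CoordinateCharSumBound_holds`, in the sibling module
`Literature.NumberTheory.EllipticCurves.KohelShparlinskiCoordinateCharSumBoundProofs`.
[cite: KohelShparlinski2000, Cor. 1 p. 399; Thm 1 and (3) pp. 398-399; Cor. 2 p. 401] -/
def CoordinateCharSumBound : Prop :=
  ∀ {F : Type} [Field F] [Fintype F] [DecidableEq F] (W : WeierstrassCurve F) [W.IsElliptic]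
    (H : AddSubgroup W.toAffine.Point) (ω : AddChar W.toAffine.Point ℂ) (ψ : AddChar F ℂ),
    ψ ≠ 0 →
      (ringChar F ≠ 2 →
        ‖affineCharSum W H ω ψ (fun x _ => x)‖ ≤ 4 * Real.sqrt (Fintype.card F)) ∧
      (ringChar F ≠ 3 →
        ‖affineCharSum W H ω ψ (fun _ y => y)‖ ≤ 6 * Real.sqrt (Fintype.card F))

namespace CoordinateCharSumBound

/-- `|S_H(ω, ψ, x)| ≤ 4 √q` (`p ≠ 2`). [cite: KohelShparlinski2000, Cor. 1] -/
theorem norm_xSum_le (hKS : CoordinateCharSumBound) (W : WeierstrassCurve F) [W.IsElliptic]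
    (H : AddSubgroup W.toAffine.Point) (ω : AddChar W.toAffine.Point ℂ) {ψ : AddChar F ℂ}
    (hψ : ψ ≠ 0) (hp : ringChar F ≠ 2) :
    ‖affineCharSum W H ω ψ (fun x _ => x)‖ ≤ 4 * Real.sqrt (Fintype.card F) :=
  (hKS W H ω ψ hψ).1 hp

/-- `|S_H(ω, ψ, y)| ≤ 6 √q` (`p ≠ 3`). [cite: KohelShparlinski2000, Cor. 1] -/
theorem norm_ySum_le (hKS : CoordinateCharSumBound) (W : WeierstrassCurve F) [W.IsElliptic]
    (H : AddSubgroup W.toAffine.Point) (ω : AddChar W.toAffine.Point ℂ) {ψ : AddChar F ℂ}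
    (hψ : ψ ≠ 0) (hp : ringChar F ≠ 3) :
    ‖affineCharSum W H ω ψ (fun _ y => y)‖ ≤ 6 * Real.sqrt (Fintype.card F) :=
  (hKS W H ω ψ hψ).2 hp

open scoped Classical in
/-- Inequality (3) for `f = x` (full group, twisted): `|Σ_{P ≠ O} ω(P) ψ(x(P))| ≤ 4 √q` for
`p ≠ 2`, `ψ` nontrivial. [cite: KohelShparlinski2000, Thm 1 and (3)] -/
theorem norm_xSum_top_le (hKS : CoordinateCharSumBound) (W : WeierstrassCurve F) [W.IsElliptic]
    (ω : AddChar W.toAffine.Point ℂ) {ψ : AddChar F ℂ} (hψ : ψ ≠ 0) (hp : ringChar F ≠ 2) :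
    ‖∑ xy : F × F, if h : W.toAffine.Nonsingular xy.1 xy.2 then
        ω (WeierstrassCurve.Affine.Point.some xy.1 xy.2 h) * ψ xy.1 else 0‖ ≤
      4 * Real.sqrt (Fintype.card F) := by
  rw [← affineCharSum_top W ω ψ (fun x _ => x)]
  exact hKS.norm_xSum_le W ⊤ ω hψ hp

open scoped Classical in
/-- Corollary 1 for `f = x`, untwisted: `|Σ_{P ∈ H, P ≠ O} ψ(x(P))| ≤ 4 √q` for every subgroup
`H ≤ E(𝔽_q)`, `p ≠ 2`, `ψ` nontrivial. [cite: KohelShparlinski2000, Cor. 1] -/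
theorem norm_xSum_subgroup_le (hKS : CoordinateCharSumBound) (W : WeierstrassCurve F)
    [W.IsElliptic] (H : AddSubgroup W.toAffine.Point) {ψ : AddChar F ℂ} (hψ : ψ ≠ 0)
    (hp : ringChar F ≠ 2) :
    ‖∑ xy : F × F, if h : W.toAffine.Nonsingular xy.1 xy.2 then
        (if WeierstrassCurve.Affine.Point.some xy.1 xy.2 h ∈ H then ψ xy.1 else 0) else 0‖ ≤
      4 * Real.sqrt (Fintype.card F) := by
  rw [← affineCharSum_one W H ψ (fun x _ => x)]
  exact hKS.norm_xSum_le W H 1 hψ hp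

/-- The prime-field case used by route `PneNP/EcdlpDefinability`: over `ZMod p`, `p` an odd
prime, `|S_H(ω, ψ, x)| ≤ 4 √p`. [cite: KohelShparlinski2000, Cor. 1] -/
theorem norm_xSum_le_zmod (hKS : CoordinateCharSumBound) {p : ℕ} [Fact p.Prime] (hp : p ≠ 2)
    (W : WeierstrassCurve (ZMod p)) [W.IsElliptic] (H : AddSubgroup W.toAffine.Point)
    (ω : AddChar W.toAffine.Point ℂ) {ψ : AddChar (ZMod p) ℂ} (hψ : ψ ≠ 0) :
    ‖affineCharSum W H ω ψ (fun x _ => x)‖ ≤ 4 * Real.sqrt p := by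
  have h := hKS.norm_xSum_le W H ω hψ (by rwa [ZMod.ringChar_zmod_n])
  rwa [ZMod.card] at h

end CoordinateCharSumBound

end KohelShparlinski

end Literature.NumberTheory.EllipticCurves
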